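import Summits.QuantumFields.BalabanUV.Beta.GAN24.LayerCommutatorSupport
import Summits.QuantumFields.BalabanUV.Beta.WardLocusParitySplit
import Summits.QuantumFields.BalabanUV.Beta.BubbleParity
import Summits.QuantumFields.BalabanUV.Beta.HessKerDressedUnits

/-!
# `BalabanUV.Beta.GAN24.LayerCommutatorAntisymm` — binder row G-an2-4 / (CONV-C), CT-W route «WC-TL» → «QR-LL» (the OWNER gan24-p1's RULING
# R-gan24p1-g25-2 + R11, journal `CLAIMS.log` l.39869 ∕ l.40020; R-gan24p1-g26-1 preview l.40158), (LAY) support lemma (C), file (A) of two: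
# **A COMMUTATOR LETTER WITH A (SIGN-)SYMMETRIC KERNEL IS (SIGN-)ANTISYMMETRIC — CHANNEL CHARGES ANTISYMMETRIC, TOTAL LIVE CHARGE ZERO —
# AND THE DIPOLE PAIRING IDENTITY WITH THE CHANNEL REMAINDER DISPLAYED**  (file (B) `LayerPushAntisymm`: persistence under the three-leg push)

NOT IN PRINT; OUR BOOKKEEPING (G-an2-4 formalisation swarm → CRUX TEAM (2), leaf prover `b2b-balaban-gan24-formalise-leaf-03`, gen 59; INTENT 1, journal
l.40211 ∕ recut l.40367; names PROVISIONAL — the OWNER ∕ leaf-01 ((LT) consumer) may rename ∕ re-cut).  [folklore] kernel algebra over an5's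
`TameKernelCalculus.trK` (`Kᵀ x y a b = K y x b a`, `trK_comp` termwise), an2's `BorderedHessian.diagK` and `BorderedHessianSymmetry.sgnK` (`sgnF = +1` on field,
`−1` on multiplier legs) BY NAME, plus one Fubini (`Summable.tsum_comm`); generic `d`; 0 `def`, 0 cited facts, 0 `def … : Prop`, 0 sorry.  HONEST FRAMING (cell
contract, verbatim): «discharging `BetaPertH` makes Bałaban's UV stability UNCONDITIONAL — a real constructive-QFT result; it is NOT the continuum limit and NOT the
Clay problem.»  HONEST DEPENDENCY (verbatim): «continuum YM on T⁴ ⇐ BetaPertH ∧ nine spine estimates (0/9 proved); BetaPertH ⇐ (D1) ∧ (D4) ∧ CAP+tail; G-an2-4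
gates asym, D1 and NE2/3/4.»

## What (R11 (i) «DISPLAY `K = Kᵀ` as the hypothesis»; R-gan24p1-g26-1 «`∀ u′ x z a b, P u′ x z a b = −P u′ z x b a` displayed»; idea-1 g35's WARD8 (0.3) CHANNEL
## CAVEAT «`K = Kᵀ` gives `Z^{ab} = −Z^{ba}`»; asym1 g107 W-1: the co-dressed step resolvent is `sgnK`-symmetric, `BubbleParity.trK_coDressKBmAt_KInvStep`)
* §1 (hypothesis-free, entrywise) `trK (diagK g) = diagK g`, `sgnK (diagK g) = diagK g`; **`trK_comm_diagK`** `(K∘diag g − diag g∘K)ᵀ = −(Kᵀ∘diag g − diag g∘Kᵀ)`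
  and `[sgnK K, diag g] = sgnK [K, diag g]`; hence under the DISPLAYED hypothesis `trK K = K` the commutator `D` is ANTISYMMETRIC (`trK D = −D`), and under
  `trK K = sgnK K` it is SIGN-ANTISYMMETRIC (`trK D = −sgnK D`: `D z x b a = −sgnF a·sgnF b·D x z a b` — antisymmetric on the ff and mm blocks, symmetric
  on the mixed ones); in both cases the ff block — the only block the three-leg push reads — obeys `D z x (inl κ₂) (inl κ₁) = −D x z (inl κ₁) (inl κ₂)`.
  The OWNER g26's W9 twin: `trK S = −sgnK S ⇒ trK [S, diag g] = +sgnK [S, diag g]` (the `C_B` letter has NO parity zero); his W9 (b) «`dM`-reads inherit the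
  tables' sign-antisymmetry» is ALREADY the tree's `KernelWardRemainderParity.parityOdd_wsum ∕ parityOdd_cwsum ∕ parityOdd_add ∕
  trK_vertexOfK_eq_neg_sgnK_of_rows` (cited, not restated).
* §2 the (LAY) instance: the interface letter `[S κ′u′, diagK(ξ•Σ_{u∈B} legInd ρ u)]` of `LayerCommutatorSupport` under either displayed hypothesis on `S κ′u′`;
  §2b THE COMB INSTANCES BY NAME (leaf-02 g53's withdrawn `CommutatorSgnSymmetry` bytes, folded per the OWNER's W10): `[G_j, diagK g]` is sign-antisymmetric for
  `G_j = coDressKBmAt (toSite r) Lc (KInvStep Lc j)` and for its unit rescalings `unitK sf sm G_j` (`BubbleParity.trK_coDressKBmAt_KInvStep`).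
* §3 LIVE CHARGE, per channel pair under the ENTRYWISE swap law `∀ x z, D x z b a = −D z x a b` (both §1 branches and leaf-01's `(K, χ)` currency are
  instances): summable over the kernel pair (`summable_prod_of_biLoc`) ⇒ **`Σ'_xΣ'_z D x z b a = −Σ'_xΣ'_z D x z a b`**, `= 0` at `b = a`; for `trK D = −D` the TOTAL
  `Σ_{a,b} Σ'_xΣ'_z D x z a b = 0`; a finite-window twin (no summability).
* §5 THE DIPOLE PAIRING IDENTITY (fibre indices kept; any finite fibre type, so the ff-restricted kernel is an instance): under the entrywise swap law,
  **`Σ'_xΣ'_zΣ_{a,b} l x a·D x z a b·r z b = ½·Σ'_xΣ'_zΣ_{a,b} D x z a b·(l x a·r z b − l z b·r x a)`**, and the pointwise three-term split of the bracket: two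
  ONE-LEG site differences across the pair + an ON-SITE fibre-antisymmetric product (zero in index-symmetric channels — the caveat; displayed, not estimated).
DISCHARGES NO ROW: no estimate with (N1′) ((LT-1′)∕(LT-1″) are leaf-01's), no audit VALUE of the σ-letters, no (LT-0), no (REP-leg); 0 estimate of Bałaban's;
NOTHING of «T2Shape» ∕ «T2Drift» ∕ (hW, hWall) ∕ (C) ∕ (Q-R) ∕ (Q-L) discharged; NEVER «G-an2-4 closed» as (CONV-C); NOT D1, NOT BetaPertH, NOT continuum, NOT Clay.
-/

noncomputable section

namespace Summit.QuantumFields.BalabanUV.Beta.GAN24.LayerCommutatorAntisymm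

open Finset
open scoped BigOperators
open Literature.MathematicalPhysics.QuantumFieldTheory
open Literature.MathematicalPhysics.QuantumFieldTheory.Balaban1983to89
open Literature.MathematicalPhysics.QuantumFieldTheory.Balaban1983to89.Beta
open Literature.MathematicalPhysics.QuantumFieldTheory.Balaban1983to89.B12Sec2to5 (l1 l1_nonneg)
open ExpKernelCalculus (MKer Site BiLoc comp summable_exp_shift')
open Summit.QuantumFields.BalabanUV.Beta.TameKernelCalculus (trK trK_apply trK_comp trK_sub)
open Summit.QuantumFields.BalabanUV.Beta.BorderedHessian (diagK diagK_apply sgnF sgnF_inl sgnF_inr sgnF_mul_self sgnK sgnK_apply comp_sgnK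
  sgnK_eq_self)
open Summit.QuantumFields.BalabanUV.Beta.ChartConjugation (conjV)
open OneStepResolventKernel (Fib)
open OneStepKernelFamily (KInvStep)
open AffineAveraging (box toSite)
open Summit.QuantumFields.BalabanUV.Beta.HessKerDressedUnits (unitK unitK_apply)
open Summit.QuantumFields.BalabanUV.Beta.AxialDressingRooted (coDressKBmAt)
open Summit.QuantumFields.BalabanUV.Beta.BubbleParity (trK_coDressKBmAt_KInvStep)
open Summit.QuantumFields.BalabanUV.Beta.AveragingWardRootedStencils (legInd)

variable {d : ℕ}

/-! ## §1 Transpose and sign algebra of the commutator with a diagonal kernel (hypothesis-free, entrywise) -/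

/-- [folklore] An ANTISYMMETRIC kernel (`trK D = −D`) changes sign under the joint swap `(x,a) ↔ (z,b)`. -/
theorem apply_swap_of_antisymm {n : ℕ} {F : Type*} {D : MKer n F} (hD : trK D = -D) (x z : Site n) (a b : F) :
    D z x b a = -D x z a b := by
  have h := congrFun (congrFun (congrFun (congrFun hD x) z) a) b
  rwa [trK_apply, Pi.neg_apply, Pi.neg_apply, Pi.neg_apply, Pi.neg_apply] at h

/-- [folklore] An antisymmetric kernel vanishes on the full diagonal `(x,a) = (z,b)` (the index-symmetric channels of WARD8 (0.3)). -/
theorem apply_diag_of_antisymm {n : ℕ} {F : Type*} {D : MKer n F} (hD : trK D = -D) (x : Site n) (a : F) : D x x a a = 0 := by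
  have h := apply_swap_of_antisymm hD x x a a
  linarith

/-- [folklore] A SYMMETRIC kernel (`trK K = K`) is invariant under the joint swap. -/
theorem apply_swap_of_symm {n : ℕ} {F : Type*} {K : MKer n F} (hK : trK K = K) (x z : Site n) (a b : F) : K z x b a = K x z a b := by
  have h := congrFun (congrFun (congrFun (congrFun hK x) z) a) b
  rwa [trK_apply] at h

/-- [folklore] A SIGN-ANTISYMMETRIC kernel (`trK D = −sgnK D`) picks up `−sgnF a·sgnF b` under the joint swap. -/
theorem apply_swap_of_sgnAntisymm {D : MKer (d + 1) (Fib d)} (hD : trK D = -sgnK D) (x z : Fin (d + 1) → ℤ) (a b : Fib d) :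
    D z x b a = -(sgnF a * sgnF b) * D x z a b := by
  have h := congrFun (congrFun (congrFun (congrFun hD x) z) a) b
  rw [trK_apply, Pi.neg_apply, Pi.neg_apply, Pi.neg_apply, Pi.neg_apply, sgnK_apply] at h
  rw [h]
  ring

/-- [folklore] **THE ff BLOCK OF A SIGN-ANTISYMMETRIC KERNEL IS ANTISYMMETRIC** (`sgnF = +1` on field legs) — the block the three-leg push reads. -/
theorem apply_swap_ff_of_sgnAntisymm {D : MKer (d + 1) (Fib d)} (hD : trK D = -sgnK D) (x z : Fin (d + 1) → ℤ) (κ₁ κ₂ : Fin (d + 1)) :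
    D z x (Sum.inl κ₂) (Sum.inl κ₁) = -D x z (Sum.inl κ₁) (Sum.inl κ₂) := by
  rw [apply_swap_of_sgnAntisymm hD, sgnF_inl, sgnF_inl]
  ring

/-- [folklore] … and so is its mm block (`sgnF = −1` twice), while the mixed blocks are SYMMETRIC under the swap. -/
theorem apply_swap_mm_of_sgnAntisymm {D : MKer (d + 1) (Fib d)} (hD : trK D = -sgnK D) (x z : Fin (d + 1) → ℤ) (μ₁ μ₂ : Fin (d + 1)) :
    D z x (Sum.inr μ₂) (Sum.inr μ₁) = -D x z (Sum.inr μ₁) (Sum.inr μ₂) := by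
  rw [apply_swap_of_sgnAntisymm hD, sgnF_inr, sgnF_inr]
  ring

/-- [folklore] The mixed fm block of a sign-antisymmetric kernel is SYMMETRIC under the swap (idea-1's caveat, block form). -/
theorem apply_swap_fm_of_sgnAntisymm {D : MKer (d + 1) (Fib d)} (hD : trK D = -sgnK D) (x z : Fin (d + 1) → ℤ) (κ μ : Fin (d + 1)) :
    D z x (Sum.inr μ) (Sum.inl κ) = D x z (Sum.inl κ) (Sum.inr μ) := by
  rw [apply_swap_of_sgnAntisymm hD, sgnF_inl, sgnF_inr]
  ring

/-- [folklore] A diagonal kernel is symmetric: `trK (diagK g) = diagK g`. -/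
theorem trK_diagK (g : (Fin (d + 1) → ℤ) → Fib d → ℝ) : trK (diagK g) = diagK g := by
  funext x y a b
  rw [trK_apply, diagK_apply, diagK_apply]
  by_cases h : x = y ∧ a = b
  · obtain ⟨rfl, rfl⟩ := h
    simp
  · rw [if_neg h, if_neg (fun h' => h ⟨h'.1.symm, h'.2.symm⟩)]

/-- [folklore] A diagonal kernel is fixed by the sign conjugation (its mixed blocks vanish). -/
theorem sgnK_diagK (g : (Fin (d + 1) → ℤ) → Fib d → ℝ) : sgnK (diagK g) = diagK g :=
  sgnK_eq_self (fun x y κ l => by rw [diagK_apply, if_neg (fun h => Sum.inl_ne_inr h.2)])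
    (fun x y κ l => by rw [diagK_apply, if_neg (fun h => Sum.inr_ne_inl h.2)])

/-- [folklore] **TRANSPOSE OF THE COMMUTATOR WITH A DIAGONAL KERNEL**: `(K∘diag g − diag g∘K)ᵀ = −(Kᵀ∘diag g − diag g∘Kᵀ)` (termwise — no summability). -/
theorem trK_comm_diagK (K : MKer (d + 1) (Fib d)) (g : (Fin (d + 1) → ℤ) → Fib d → ℝ) :
    trK (comp K (diagK g) - comp (diagK g) K) = -(comp (trK K) (diagK g) - comp (diagK g) (trK K)) := by
  rw [trK_sub, trK_comp, trK_comp, trK_diagK, neg_sub]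

/-- [folklore] **THE SIGN CONJUGATION PASSES THROUGH THE COMMUTATOR**: `[sgnK K, diag g] = sgnK [K, diag g]` (`comp_sgnK`, `sgnK_diagK`). -/
theorem comm_diagK_sgnK (K : MKer (d + 1) (Fib d)) (g : (Fin (d + 1) → ℤ) → Fib d → ℝ) :
    comp (sgnK K) (diagK g) - comp (diagK g) (sgnK K) = sgnK (comp K (diagK g) - comp (diagK g) K) := by
  rw [WardLocusParitySplit.sgnK_sub, ← comp_sgnK, ← comp_sgnK, sgnK_diagK]

/-- [folklore] **R11 (i), THE DISPLAYED HYPOTHESIS (plain branch)**: `trK K = K ⇒ trK (K∘diag g − diag g∘K) = −(K∘diag g − diag g∘K)`. -/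
theorem trK_comm_diagK_of_symm {K : MKer (d + 1) (Fib d)} (hK : trK K = K) (g : (Fin (d + 1) → ℤ) → Fib d → ℝ) :
    trK (comp K (diagK g) - comp (diagK g) K) = -(comp K (diagK g) - comp (diagK g) K) := by
  rw [trK_comm_diagK, hK]

/-- [folklore] **THE DISPLAYED HYPOTHESIS (sign branch — the tree's propagators, `BorderedHessianSymmetry.trK_KInv`, `BubbleParity.trK_coDressKBmAt_KInvStep`)**:
`trK K = sgnK K ⇒ trK (K∘diag g − diag g∘K) = −sgnK (K∘diag g − diag g∘K)`. -/
theorem trK_comm_diagK_of_sgnSymm {K : MKer (d + 1) (Fib d)} (hK : trK K = sgnK K) (g : (Fin (d + 1) → ℤ) → Fib d → ℝ) :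
    trK (comp K (diagK g) - comp (diagK g) K) = -sgnK (comp K (diagK g) - comp (diagK g) K) := by
  rw [trK_comm_diagK, hK, comm_diagK_sgnK]

/-- [folklore] **THE OWNER's TWIN (W9 (a)): A SIGN-ANTISYMMETRIC STENCIL GIVES A SIGN-SYMMETRIC COMMUTATOR** — `trK S = −sgnK S ⇒ trK [S, diag g] = +sgnK [S, diag g]`
(the `C_B = [S_j, X_B]` letter of the table law: NO parity zero; harmless — it is never transported). -/
theorem trK_comm_diagK_of_sgnAntisymm {S : MKer (d + 1) (Fib d)} (hS : trK S = -sgnK S) (g : (Fin (d + 1) → ℤ) → Fib d → ℝ) :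
    trK (comp S (diagK g) - comp (diagK g) S) = sgnK (comp S (diagK g) - comp (diagK g) S) := by
  rw [trK_comm_diagK, hS, TameKernelCalculus.comp_neg_left, TameKernelCalculus.comp_neg_right, ← comm_diagK_sgnK]
  abel

/-- [folklore] The `conjV` spelling (`conjV M X = M∘X − X∘M`), plain branch. -/
theorem trK_conjV_diagK_of_symm {K : MKer (d + 1) (Fib d)} (hK : trK K = K) (g : (Fin (d + 1) → ℤ) → Fib d → ℝ) :
    trK (conjV K (diagK g)) = -conjV K (diagK g) := by
  unfold ChartConjugation.conjV
  exact trK_comm_diagK_of_symm hK g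

/-- [folklore] The `conjV` spelling, sign branch. -/
theorem trK_conjV_diagK_of_sgnSymm {K : MKer (d + 1) (Fib d)} (hK : trK K = sgnK K) (g : (Fin (d + 1) → ℤ) → Fib d → ℝ) :
    trK (conjV K (diagK g)) = -sgnK (conjV K (diagK g)) := by
  unfold ChartConjugation.conjV
  exact trK_comm_diagK_of_sgnSymm hK g

/-- [folklore] Entrywise, plain branch: `[K, diag g] z x b a = −[K, diag g] x z a b`. -/
theorem comm_diagK_swap {K : MKer (d + 1) (Fib d)} (hK : trK K = K) (g : (Fin (d + 1) → ℤ) → Fib d → ℝ) (x z : Fin (d + 1) → ℤ)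
    (a b : Fib d) : (comp K (diagK g) - comp (diagK g) K) z x b a = -(comp K (diagK g) - comp (diagK g) K) x z a b :=
  apply_swap_of_antisymm (trK_comm_diagK_of_symm hK g) x z a b

/-- [folklore] Entrywise, sign branch, ff block: `[K, diag g] z x (inl κ₂) (inl κ₁) = −[K, diag g] x z (inl κ₁) (inl κ₂)`. -/
theorem comm_diagK_swap_ff {K : MKer (d + 1) (Fib d)} (hK : trK K = sgnK K) (g : (Fin (d + 1) → ℤ) → Fib d → ℝ) (x z : Fin (d + 1) → ℤ)
    (κ₁ κ₂ : Fin (d + 1)) :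
    (comp K (diagK g) - comp (diagK g) K) z x (Sum.inl κ₂) (Sum.inl κ₁) = -(comp K (diagK g) - comp (diagK g) K) x z (Sum.inl κ₁) (Sum.inl κ₂) :=
  apply_swap_ff_of_sgnAntisymm (trK_comm_diagK_of_sgnSymm hK g) x z κ₁ κ₂

/-! ## §2 The (LAY) instance: the block gauge generator `ξ • Σ_{u∈B} legInd ρ u` -/

/-- [folklore] **THE (LAY) COMMUTATOR LETTER IS ANTISYMMETRIC UNDER `trK (S κ′u′) = S κ′u′`** — for every finite region `B`, root offset `ρ`, weight `ξ`, the interface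
letter `[S κ′u′, diagK (ξ • Σ_{u∈B} legInd ρ u)]` of `LayerCommutatorSupport.comm_diagK_legInd_entry` satisfies `trK D = −D`. -/
theorem trK_comm_legInd_of_symm (S : Fin (d + 1) → (Fin (d + 1) → ℤ) → MKer (d + 1) (Fib d)) (κ' : Fin (d + 1)) (u' : Fin (d + 1) → ℤ)
    (hS : trK (S κ' u') = S κ' u') (B : Finset (Fin (d + 1) → ℤ)) (ρ : Fin (d + 1) → ℤ) (ξ : ℝ) :
    trK (comp (S κ' u') (diagK (ξ • ∑ u ∈ B, legInd ρ u)) - comp (diagK (ξ • ∑ u ∈ B, legInd ρ u)) (S κ' u'))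
      = -(comp (S κ' u') (diagK (ξ • ∑ u ∈ B, legInd ρ u)) - comp (diagK (ξ • ∑ u ∈ B, legInd ρ u)) (S κ' u')) :=
  trK_comm_diagK_of_symm hS _

/-- [folklore] **… AND SIGN-ANTISYMMETRIC UNDER `trK (S κ′u′) = sgnK (S κ′u′)`** (`trK D = −sgnK D`; ff block antisymmetric by `apply_swap_ff_of_sgnAntisymm`). -/
theorem trK_comm_legInd_of_sgnSymm (S : Fin (d + 1) → (Fin (d + 1) → ℤ) → MKer (d + 1) (Fib d)) (κ' : Fin (d + 1)) (u' : Fin (d + 1) → ℤ)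
    (hS : trK (S κ' u') = sgnK (S κ' u')) (B : Finset (Fin (d + 1) → ℤ)) (ρ : Fin (d + 1) → ℤ) (ξ : ℝ) :
    trK (comp (S κ' u') (diagK (ξ • ∑ u ∈ B, legInd ρ u)) - comp (diagK (ξ • ∑ u ∈ B, legInd ρ u)) (S κ' u'))
      = -sgnK (comp (S κ' u') (diagK (ξ • ∑ u ∈ B, legInd ρ u)) - comp (diagK (ξ • ∑ u ∈ B, legInd ρ u)) (S κ' u')) :=
  trK_comm_diagK_of_sgnSymm hS _

/-! ## §2b The comb instances BY NAME (leaf-02 g53's withdrawn `CommutatorSgnSymmetry` bytes, folded per the OWNER's W10): the co-dressed step resolvents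
## `G_j = coDressKBmAt (toSite r) Lc (KInvStep Lc j)` are `sgnK`-symmetric (`BubbleParity.trK_coDressKBmAt_KInvStep`), and so are their unit rescalings -/

/-- [folklore] Transpose commutes with the unit rescaling `unitK sf sm` (leaf-02 g53). -/
theorem trK_unitK (sf sm : ℝ) (K : MKer (d + 1) (Fib d)) : trK (unitK sf sm K) = unitK sf sm (trK K) := by
  funext x y a b
  simp only [trK_apply, unitK_apply]
  ring

/-- [folklore] Sign conjugation commutes with the unit rescaling (leaf-02 g53). -/
theorem sgnK_unitK (sf sm : ℝ) (K : MKer (d + 1) (Fib d)) : sgnK (unitK sf sm K) = unitK sf sm (sgnK K) := by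
  funext x y a b
  simp only [sgnK_apply, unitK_apply]
  ring

/-- [folklore] **UNIT RESCALING PRESERVES `sgnK`-SYMMETRY** (leaf-02 g53): `trK K = sgnK K ⟹ trK (unitK sf sm K) = sgnK (unitK sf sm K)`. -/
theorem trK_unitK_eq_sgnK {K : MKer (d + 1) (Fib d)} (hK : trK K = sgnK K) (sf sm : ℝ) : trK (unitK sf sm K) = sgnK (unitK sf sm K) := by
  rw [trK_unitK, hK, sgnK_unitK]

section Comb

variable {Lc : ℕ} [NeZero Lc] {r : Fin (d + 1) → ℕ}

/-- [folklore] **`[G_j, diagK g]` IS SIGN-ANTISYMMETRIC** for the co-dressed comb resolvent at every level `j` and in-block root (leaf-02 g53; `trK_coDressKBmAt_KInvStep`). -/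
theorem trK_comm_diagK_coDress (hr : r ∈ box (d + 1) Lc) (j : ℕ) (g : (Fin (d + 1) → ℤ) → Fib d → ℝ) :
    trK (comp (coDressKBmAt (toSite r) Lc (KInvStep (d := d) Lc j)) (diagK g) - comp (diagK g) (coDressKBmAt (toSite r) Lc (KInvStep (d := d) Lc j)))
      = -sgnK (comp (coDressKBmAt (toSite r) Lc (KInvStep (d := d) Lc j)) (diagK g) - comp (diagK g) (coDressKBmAt (toSite r) Lc (KInvStep (d := d) Lc j))) :=
  trK_comm_diagK_of_sgnSymm (trK_coDressKBmAt_KInvStep hr j) g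

/-- [folklore] … hence ANTISYMMETRIC ON THE ff BLOCK (the (α) audit's swap identity; leaf-02 g53). -/
theorem comm_diagK_coDress_swap_ff (hr : r ∈ box (d + 1) Lc) (j : ℕ) (g : (Fin (d + 1) → ℤ) → Fib d → ℝ) (x z : Fin (d + 1) → ℤ) (κ₁ κ₂ : Fin (d + 1)) :
    (comp (coDressKBmAt (toSite r) Lc (KInvStep (d := d) Lc j)) (diagK g) - comp (diagK g) (coDressKBmAt (toSite r) Lc (KInvStep (d := d) Lc j)))
        z x (Sum.inl κ₂) (Sum.inl κ₁)
      = -(comp (coDressKBmAt (toSite r) Lc (KInvStep (d := d) Lc j)) (diagK g) - comp (diagK g) (coDressKBmAt (toSite r) Lc (KInvStep (d := d) Lc j)))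
        x z (Sum.inl κ₁) (Sum.inl κ₂) :=
  comm_diagK_swap_ff (trK_coDressKBmAt_KInvStep hr j) g x z κ₁ κ₂

/-- [folklore] The UNIT-RESCALED co-dressed resolvent `unitK sf sm G_j` is `sgnK`-symmetric (any units; leaf-02 g53). -/
theorem trK_unitK_coDress (hr : r ∈ box (d + 1) Lc) (j : ℕ) (sf sm : ℝ) :
    trK (unitK sf sm (coDressKBmAt (toSite r) Lc (KInvStep (d := d) Lc j))) = sgnK (unitK sf sm (coDressKBmAt (toSite r) Lc (KInvStep (d := d) Lc j))) :=
  trK_unitK_eq_sgnK (trK_coDressKBmAt_KInvStep hr j) sf sm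

/-- [folklore] … and its commutator with a diagonal generator is sign-antisymmetric (leaf-02 g53). -/
theorem trK_comm_diagK_unitK_coDress (hr : r ∈ box (d + 1) Lc) (j : ℕ) (sf sm : ℝ) (g : (Fin (d + 1) → ℤ) → Fib d → ℝ) :
    trK (comp (unitK sf sm (coDressKBmAt (toSite r) Lc (KInvStep (d := d) Lc j))) (diagK g)
        - comp (diagK g) (unitK sf sm (coDressKBmAt (toSite r) Lc (KInvStep (d := d) Lc j))))
      = -sgnK (comp (unitK sf sm (coDressKBmAt (toSite r) Lc (KInvStep (d := d) Lc j))) (diagK g)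
        - comp (diagK g) (unitK sf sm (coDressKBmAt (toSite r) Lc (KInvStep (d := d) Lc j)))) :=
  trK_comm_diagK_of_sgnSymm (trK_unitK_coDress hr j sf sm) g

end Comb

/-! ## §3 Live charge: channel charges antisymmetric, total charge zero -/

/-- [folklore] A `BiLoc` letter at a positive rate is absolutely summable over the kernel PAIR `(x,z)` in every channel. -/
theorem summable_prod_of_biLoc {n : ℕ} {F : Type*} {D : MKer n F} {p q : Site n} {C δ : ℝ} (hD : BiLoc D p q C δ) (hδ : 0 < δ)
    (a b : F) : Summable fun xz : Site n × Site n => D xz.1 xz.2 a b := by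
  have hC : 0 ≤ C := hD.nonneg a
  refine Summable.of_norm_bounded
    (g := fun xz : Site n × Site n => C * (Real.exp (-δ * l1 (xz.1 - p)) * Real.exp (-δ * l1 (xz.2 - q)))) ?_ ?_
  · exact ((summable_exp_shift' hδ p).mul_of_nonneg (summable_exp_shift' hδ q) (fun _ => (Real.exp_pos _).le)
      (fun _ => (Real.exp_pos _).le)).mul_left C
  · intro xz
    rw [Real.norm_eq_abs]
    calc |D xz.1 xz.2 a b| ≤ C * Real.exp (-δ * (l1 (xz.1 - p) + l1 (xz.2 - q))) := hD xz.1 xz.2 a b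
      _ = C * (Real.exp (-δ * l1 (xz.1 - p)) * Real.exp (-δ * l1 (xz.2 - q))) := by rw [mul_add, Real.exp_add]

/-- [folklore] **THE CHANNEL CHARGE SWAP LAW** (idea-1's WARD8 (0.3) CHANNEL CAVEAT as a lemma): if the channel pair `(a,b)` obeys the entrywise swap law
`D x z b a = −D z x a b` and the `(a,b)`-channel is summable over the pair, then `Σ'_x Σ'_z D x z b a = −Σ'_x Σ'_z D x z a b` — one `Summable.tsum_comm`. -/
theorem tsum_tsum_swap_eq_neg {n : ℕ} {F : Type*} {D : MKer n F} {a b : F} (h : ∀ x z, D x z b a = -D z x a b)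
    (hs : Summable fun xz : Site n × Site n => D xz.1 xz.2 a b) :
    ∑' x, ∑' z, D x z b a = -∑' x, ∑' z, D x z a b := by
  simp_rw [h, tsum_neg]
  rw [neg_inj]
  have hu : Summable (Function.uncurry fun z x => D z x a b) := hs.congr fun _ => rfl
  exact hu.tsum_comm

/-- [folklore] Plain branch, every channel pair: `trK D = −D ⇒ Z b a = −Z a b`. -/
theorem tsum_tsum_swap_eq_neg_of_antisymm {n : ℕ} {F : Type*} {D : MKer n F} (hD : trK D = -D) (a b : F)
    (hs : Summable fun xz : Site n × Site n => D xz.1 xz.2 a b) :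
    ∑' x, ∑' z, D x z b a = -∑' x, ∑' z, D x z a b :=
  tsum_tsum_swap_eq_neg (fun x z => apply_swap_of_antisymm hD z x a b) hs

/-- [folklore] **NO LIVE CHARGE IN THE INDEX-SYMMETRIC CHANNELS** (plain branch): `Z a a = 0`. -/
theorem tsum_tsum_diag_eq_zero_of_antisymm {n : ℕ} {F : Type*} {D : MKer n F} (hD : trK D = -D) (a : F)
    (hs : Summable fun xz : Site n × Site n => D xz.1 xz.2 a a) : ∑' x, ∑' z, D x z a a = 0 := by
  have h := tsum_tsum_swap_eq_neg_of_antisymm hD a a hs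
  linarith

/-- [folklore] **ZERO TOTAL LIVE CHARGE** (plain branch): `Σ_{a,b} Σ'_x Σ'_z D x z a b = 0`. -/
theorem sum_tsum_tsum_eq_zero_of_antisymm {n : ℕ} {F : Type*} [Fintype F] {D : MKer n F} (hD : trK D = -D)
    (hs : ∀ a b, Summable fun xz : Site n × Site n => D xz.1 xz.2 a b) :
    ∑ a, ∑ b, ∑' x, ∑' z, D x z a b = 0 := by
  have h : ∑ a, ∑ b, ∑' x, ∑' z, D x z a b = -∑ a, ∑ b, ∑' x, ∑' z, D x z a b := by
    conv_lhs => rw [Finset.sum_comm]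
    rw [← Finset.sum_neg_distrib]
    refine Finset.sum_congr rfl fun a _ => ?_
    rw [← Finset.sum_neg_distrib]
    refine Finset.sum_congr rfl fun b _ => ?_
    exact tsum_tsum_swap_eq_neg_of_antisymm hD a b (hs a b)
  linarith

/-- [folklore] Sign branch, ff channels: `trK D = −sgnK D ⇒ Z (inl κ₂) (inl κ₁) = −Z (inl κ₁) (inl κ₂)` and the ff-diagonal charges vanish. -/
theorem tsum_tsum_swap_ff_eq_neg_of_sgnAntisymm {D : MKer (d + 1) (Fib d)} (hD : trK D = -sgnK D) (κ₁ κ₂ : Fin (d + 1))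
    (hs : Summable fun xz : (Fin (d + 1) → ℤ) × (Fin (d + 1) → ℤ) => D xz.1 xz.2 (Sum.inl κ₁) (Sum.inl κ₂)) :
    ∑' x, ∑' z, D x z (Sum.inl κ₂) (Sum.inl κ₁) = -∑' x, ∑' z, D x z (Sum.inl κ₁) (Sum.inl κ₂) :=
  tsum_tsum_swap_eq_neg (fun x z => apply_swap_ff_of_sgnAntisymm hD z x κ₁ κ₂) hs

/-- [folklore] FINITE-WINDOW twin (no summability): over ONE finite set of sites in both kernel arguments, under the entrywise swap law for the pair `(a,b)`,
`Σ_{x∈W} Σ_{z∈W} D x z b a = −Σ_{x∈W} Σ_{z∈W} D x z a b`. -/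
theorem sum_sum_swap_eq_neg {n : ℕ} {F : Type*} {D : MKer n F} {a b : F} (h : ∀ x z, D x z b a = -D z x a b) (W : Finset (Site n)) :
    ∑ x ∈ W, ∑ z ∈ W, D x z b a = -∑ x ∈ W, ∑ z ∈ W, D x z a b := by
  simp_rw [h, Finset.sum_neg_distrib]
  rw [neg_inj, Finset.sum_comm]

/-! ## §5 The dipole pairing identity, fibre indices kept -/

/-- [folklore] **THE DIPOLE PAIRING IDENTITY** (R11's `Σ A(X,x)A(Z,z)D = ½ΣD·[A(X,x)A(Z,z) − A(X,z)A(Z,x)]` with the fibre indices kept): for a kernel obeying the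
entrywise swap law on every channel pair and leg weights `l r : Site → F → ℝ` whose pairing is absolutely summable over the kernel pair,
`Σ'_x Σ'_z Σ_{a,b} l x a·D x z a b·r z b = ½·Σ'_x Σ'_z Σ_{a,b} D x z a b·(l x a·r z b − l z b·r x a)` — one Fubini and the swap `(x,a) ↔ (z,b)`.  Any finite
fibre type `F`: the ff-restricted kernel `fun x z κ₁ κ₂ => S x z (inl κ₁) (inl κ₂)` of a sign-antisymmetric letter is an instance. -/
theorem pairing_eq_half_antisymm {n : ℕ} {F : Type*} [Fintype F] {D : MKer n F} (hD : ∀ x z a b, D z x b a = -D x z a b)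
    (l r : Site n → F → ℝ) (hs : Summable (Function.uncurry fun x z => ∑ a, ∑ b, l x a * D x z a b * r z b)) :
    ∑' x, ∑' z, ∑ a, ∑ b, l x a * D x z a b * r z b
      = (1 / 2) * ∑' x, ∑' z, ∑ a, ∑ b, D x z a b * (l x a * r z b - l z b * r x a) := by
  set f : Site n → Site n → ℝ := fun x z => ∑ a, ∑ b, l x a * D x z a b * r z b with hf
  have hswap : ∀ x z, ∑ a, ∑ b, D x z a b * (l z b * r x a) = -f z x := by
    intro x z
    simp only [hf]
    rw [Finset.sum_comm, ← Finset.sum_neg_distrib]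
    refine Finset.sum_congr rfl fun b _ => ?_
    rw [← Finset.sum_neg_distrib]
    refine Finset.sum_congr rfl fun a _ => ?_
    rw [show D x z a b = -D z x b a by rw [hD z x b a]]
    ring
  have hsplit : ∀ x z, ∑ a, ∑ b, D x z a b * (l x a * r z b - l z b * r x a) = f x z + f z x := by
    intro x z
    have h1 : ∑ a, ∑ b, D x z a b * (l x a * r z b - l z b * r x a)
        = (∑ a, ∑ b, l x a * D x z a b * r z b) - ∑ a, ∑ b, D x z a b * (l z b * r x a) := by
      rw [← Finset.sum_sub_distrib]
      refine Finset.sum_congr rfl fun a _ => ?_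
      rw [← Finset.sum_sub_distrib]
      refine Finset.sum_congr rfl fun b _ => ?_
      ring
    rw [h1, hswap]
    simp only [hf]
    ring
  simp_rw [hsplit]
  have hrow : ∀ x, Summable (f x) := fun x => hs.prod_factor x
  have hcol : ∀ x, Summable fun z => f z x := fun x => hs.prod_symm.prod_factor x
  have hA : ∀ x, ∑' z, (f x z + f z x) = (∑' z, f x z) + ∑' z, f z x := fun x => (hrow x).tsum_add (hcol x)
  simp_rw [hA]
  have hB1 : Summable fun x => ∑' z, f x z := hs.prod
  have hB2 : Summable fun x => ∑' z, f z x := hs.prod_symm.prod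
  rw [hB1.tsum_add hB2, ← hs.tsum_comm]
  ring

/-- [folklore] **THE THREE-TERM SPLIT OF THE BRACKET** (pointwise): two ONE-LEG site differences across the pair `(x,z)` — where an (N1′)-type unit-gradient gain of
the legs is cashed, `|x−z|₁` unit steps inside the letter's own range — plus an ON-SITE fibre-antisymmetric product (idea-1's CHANNEL CAVEAT; zero at `a = b`):
`l x a·r z b − l z b·r x a = (l x a − l z a)·r z b + l z b·(r z a − r x a) + (l z a·r z b − l z b·r z a)`. -/
theorem bracket_split {n : ℕ} {F : Type*} (l r : Site n → F → ℝ) (x z : Site n) (a b : F) :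
    l x a * r z b - l z b * r x a = (l x a - l z a) * r z b + l z b * (r z a - r x a) + (l z a * r z b - l z b * r z a) := by
  ring

/-- [folklore] Termwise absolute bound of the antisymmetrised summand by the three pieces of `bracket_split`. -/
theorem abs_term_le {n : ℕ} {F : Type*} (D : MKer n F) (l r : Site n → F → ℝ) (x z : Site n) (a b : F) :
    |D x z a b * (l x a * r z b - l z b * r x a)|
      ≤ |D x z a b| * (|l x a - l z a| * |r z b| + |l z b| * |r z a - r x a| + |l z a * r z b - l z b * r z a|) := by
  rw [abs_mul, bracket_split]
  refine mul_le_mul_of_nonneg_left ?_ (abs_nonneg _)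
  calc |(l x a - l z a) * r z b + l z b * (r z a - r x a) + (l z a * r z b - l z b * r z a)|
      ≤ |(l x a - l z a) * r z b + l z b * (r z a - r x a)| + |l z a * r z b - l z b * r z a| := abs_add_le _ _
    _ ≤ |(l x a - l z a) * r z b| + |l z b * (r z a - r x a)| + |l z a * r z b - l z b * r z a| := by
        gcongr
        exact abs_add_le _ _
    _ = _ := by rw [abs_mul, abs_mul]

/-! ## §6 (v1.4, gen 60 — append-only) The ff-diagonal channel in the sign branch -/

/-- [folklore] Sign branch, ff-DIAGONAL channel: `trK D = −sgnK D ⇒ Z (inl κ) (inl κ) = 0` — the two-line corollary of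
`tsum_tsum_swap_ff_eq_neg_of_sgnAntisymm` at `κ₁ = κ₂` that its docstring announces («the ff-diagonal charges vanish»; leaf-02 g54's X1 INFO I1;
the OWNER gan24-p1 g26's parity fact of record «diagonal channels charge-free at every level», RULING R-gan24p1-g26-1 (2)). -/
theorem tsum_tsum_diag_ff_eq_zero_of_sgnAntisymm {D : MKer (d + 1) (Fib d)} (hD : trK D = -sgnK D) (κ : Fin (d + 1))
    (hs : Summable fun xz : (Fin (d + 1) → ℤ) × (Fin (d + 1) → ℤ) => D xz.1 xz.2 (Sum.inl κ) (Sum.inl κ)) :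
    ∑' x, ∑' z, D x z (Sum.inl κ) (Sum.inl κ) = 0 := by
  have h := tsum_tsum_swap_ff_eq_neg_of_sgnAntisymm hD κ κ hs
  linarith

end Summit.QuantumFields.BalabanUV.Beta.GAN24.LayerCommutatorAntisymm

end
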